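import Mathlib
import Literature.MathematicalPhysics.QuantumLattice.WilsonDiracAP
import Summits.QuantumFields.QCD.Theorems.QuarksAsStableActionCriticalLineDiamagnetismStubFreeDetFormula
import Summits.QuantumFields.QCD.Theorems.QuarksAsStableActionCriticalLineDiamagnetismStubFreeBlochBlocks
import Summits.QuantumFields.QCD.Theorems.QuarksAsStableActionCriticalLineDiamagnetismStubCellDetFactorisation
import Summits.QuantumFields.QCD.Theorems.QuarksAsStableActionCriticalLineDiamagnetismStubDeltaBounds
import Summits.QuantumFields.QCD.Theorems.QuarksAsStableActionCriticalLineDiamagnetismStubBlochLatticeSum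
import Summits.QuantumFields.QCD.Theorems.QuarksAsStableActionCriticalLineDiamagnetismStubTilingCellData
import Summits.QuantumFields.QCD.Theorems.QuarksAsStableActionCriticalLineDiamagnetismStubCellGainOfGauged
import Summits.QuantumFields.QCD.Theorems.QuarksAsStableActionCriticalLineDiamagnetismStubBlockEstimate

/-!
# The one-cell gain in tiling form from the one-loop margin (assembly)
(helper for crux stmt-QuantumFields-9734, line `Sketch`, stub `stub_cellGainCore`)

What.  The one-loop margin `P6` (hypothesis) implies the one-cell gain in tiling form for cells in a
good gauge on the even tori `(ℤ/2M)⁴`: for every `C_B` there are `η, c_g, K_g, ε > 0`-data with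
`‖det D_AP[tile_c V]‖ ≤ exp(K_g − c_g M⁴ S_cell) ‖det D_AP[1]‖` whenever the cell links of `V` are
`η`-close to `1`, `|m| ≤ ε` and `F_cell ≤ C_B S_cell` (`S_cell` the plaquette deficit of the closed
cell, `F_cell` the cell-link deficit).

How (all ingredients landed in sibling files of this line).
* (1) phases `ω = e^{iπ/2M}·1`, `ζ_k(μ) = e^{iπk_μ/M}·1` (`FreeDetFormula.phase_mem_unitaryGroup`,
  `CellGainCore.exists_zeta`); `ζ_k(μ) ω = e^{iθ_{k,μ}}·1`, `θ_{k,μ} = πk_μ/M + π/(2M)`.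
* (2) Bloch factorisation `det D_AP[tile_c V] = ∏_k det B_k`, `det D_AP[1] = ∏_k det B⁰_k`
  (`stub_cellDetFactorisation`).
* (3) the free blocks: `B⁰_k` is coercive with constant `h_min(k) = min_s h_k(s) > 0`
  (`stub_freeBlochBlocks`; positivity `CellGainCore.symbol_pos`: `sin² θ_{k,0} > 0`).
* (4) `Δ_k = B_k − B⁰_k`: `‖Δ_k‖_F² ≤ C_F F'`, `Σ‖Δ_k v‖² ≤ C_op a² Σ‖v‖²` (`stub_deltaBounds`) with
  `a²` the maximal and `F'` the total link deficit of the cell field `W_c`; `a² ≤ η`, `F' ≤ 2 F_cell`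
  (`stub_tilingCellData`).
* (5) per block `‖det B_k‖ ≤ ‖det B⁰_k‖ exp(q_k + E · h_min(k)^{-3/2})` (`stub_blockEstimate`),
  `q_k = Re tr R_k − Re tr R_k²/2`, `R_k = (B⁰_k)⁻¹ Δ_k`, `E ≤ C₁ a F'` (`CellGainCore.err_le`).
* (6)–(7) product → sum (`CellGainCore.norm_prod_le_exp`) and the lattice sum
  `Σ_k h_min(k)^{-3/2} ≤ Σ_k Σ_s h_k(s)^{-3/2} ≤ C_Σ M⁴` (`stub_blochLatticeSum`).
* (9)–(10) `P6` bounds `Σ_k q_k ≤ K_q − c_q M⁴ S + C_q √η M⁴ F`; with `F ≤ C_B S` and `η` small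
  (`CellGainCore.exists_eta`) the exponent is `≤ K_q − (c_q/2) M⁴ S` (`CellGainCore.exponent_le`).

References: Montvay–Münster, *Quantum Fields on a Lattice* §4.2 (free Wilson fermions, twisted
boundary conditions); Seiler, LNP 159 Ch. 3 (determinant bounds). Pure theorem file (no `def`s).
-/

noncomputable section

open scoped BigOperators Classical Matrix ComplexConjugate
open Finset
open Literature.MathematicalPhysics.QuantumLattice Literature.MathematicalPhysics.QuantumFieldTheory
  Literature.Probability.LatticeModels

namespace Summit.QuantumFields.QCD.Cruxes.CriticalLineDiamagnetism.ChessboardCellGain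

namespace CellGainCore

/-! ### Phases -/

/-- A scalar phase matrix `e^{iθ}·1` is unitary. -/
theorem exp_smul_one_mem (θ : ℝ) :
    Complex.exp (↑θ * Complex.I) • (1 : Matrix (Fin 3) (Fin 3) ℂ) ∈
      Matrix.unitaryGroup (Fin 3) ℂ := by
  -- adapted from `FreeDetFormula.phase_mem_unitaryGroup`
  refine Unitary.smul_mem_of_mem ?_ (one_mem _)
  rw [Unitary.mem_iff, Complex.star_def, Complex.conj_mul', Complex.mul_conj',
    Complex.norm_exp_ofReal_mul_I]
  simp

/-- The Bloch phases `ζ_k(μ) = e^{iπ k_μ/M}·1 ∈ U(3)` exist. -/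
theorem exists_zeta (M : ℕ) : ∃ ζ : (Fin 4 → Fin M) → Fin 4 → Matrix.unitaryGroup (Fin 3) ℂ,
    ∀ k μ, ((ζ k μ : Matrix.unitaryGroup (Fin 3) ℂ) : Matrix (Fin 3) (Fin 3) ℂ) =
      Complex.exp (Real.pi * Complex.I * ((k μ : ℕ) : ℂ) / (M : ℂ)) •
        (1 : Matrix (Fin 3) (Fin 3) ℂ) := by
  have h : ∀ (k : Fin 4 → Fin M) (μ : Fin 4), Real.pi * Complex.I * ((k μ : ℕ) : ℂ) / (M : ℂ) =
      ↑(Real.pi * ((k μ : ℕ) : ℝ) / M : ℝ) * Complex.I := by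
    intro k μ; push_cast; ring
  refine ⟨fun k μ => ⟨Complex.exp (Real.pi * Complex.I * ((k μ : ℕ) : ℂ) / (M : ℂ)) • 1, ?_⟩,
    fun k μ => rfl⟩
  rw [h]
  exact exp_smul_one_mem _

/-- `ζ_k(μ) · ω` is the scalar phase `e^{iθ}·1` with `θ = π k_μ/M + π/(2M)`. -/
theorem coe_zeta_mul_omega {M k : ℕ} {ω z : Matrix.unitaryGroup (Fin 3) ℂ}
    (hω : (ω : Matrix (Fin 3) (Fin 3) ℂ) =
      Complex.exp (↑(Real.pi / (2 * M : ℕ)) * Complex.I) • (1 : Matrix (Fin 3) (Fin 3) ℂ))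
    (hz : (z : Matrix (Fin 3) (Fin 3) ℂ) =
      Complex.exp (Real.pi * Complex.I * (k : ℂ) / (M : ℂ)) • (1 : Matrix (Fin 3) (Fin 3) ℂ)) :
    ((z * ω : Matrix.unitaryGroup (Fin 3) ℂ) : Matrix (Fin 3) (Fin 3) ℂ) =
      Complex.exp (↑(Real.pi * (k : ℝ) / M + Real.pi / (2 * M)) * Complex.I) •
        (1 : Matrix (Fin 3) (Fin 3) ℂ) := by
  rw [Matrix.UnitaryGroup.mul_val]
  change (z : Matrix (Fin 3) (Fin 3) ℂ) * ω = _
  rw [hω, hz, smul_mul_assoc, one_mul, smul_smul, ← Complex.exp_add]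
  congr 2
  push_cast
  ring

/-! ### Positivity of the free symbol at the Bloch angles -/

/-- `sin² (π v + (π k/M + π/(2M))) > 0` for `k < M`, `v ∈ ℕ`: the angle `(2k+1)π/(2M)` lies in
`(0, π)`. -/
theorem sin_sq_pos {M k : ℕ} (v : ℕ) (hk : k < M) :
    0 < Real.sin (Real.pi * (v : ℝ) + (Real.pi * (k : ℝ) / M + Real.pi / (2 * M))) ^ 2 := by
  have hM : (0 : ℝ) < M := by exact_mod_cast (Nat.zero_le k).trans_lt hk
  have h2 : (2 * k + 1 : ℝ) < 2 * M := by exact_mod_cast (by omega : 2 * k + 1 < 2 * M)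
  have hx : Real.pi * (k : ℝ) / M + Real.pi / (2 * M) = Real.pi * ((2 * k + 1) / (2 * M)) := by
    field_simp
  have hlt : (2 * k + 1 : ℝ) / (2 * M) < 1 := (div_lt_one (by positivity)).2 h2
  have hsin : 0 < Real.sin (Real.pi * (k : ℝ) / M + Real.pi / (2 * M)) := by
    rw [hx]
    refine Real.sin_pos_of_pos_of_lt_pi (by positivity) ?_
    nlinarith [Real.pi_pos]
  rw [show Real.pi * (v : ℝ) + (Real.pi * (k : ℝ) / M + Real.pi / (2 * M)) =
      (Real.pi * (k : ℝ) / M + Real.pi / (2 * M)) + v * Real.pi by ring, Real.sin_add_nat_mul_pi]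
  exact sq_pos_iff.mpr (mul_ne_zero (pow_ne_zero _ (by norm_num)) hsin.ne')

/-- The free symbol `h_k(s)` at the Bloch angles is positive. -/
theorem symbol_pos {M : ℕ} (m : ℝ) (k : Fin 4 → Fin M) (s : Fin 4 → ZMod 2) :
    0 < (m + ∑ μ : Fin 4, (1 - Real.cos (Real.pi * ((s μ).val : ℝ) +
        (Real.pi * ((k μ : ℕ) : ℝ) / M + Real.pi / (2 * M))))) ^ 2 +
      ∑ μ : Fin 4, Real.sin (Real.pi * ((s μ).val : ℝ) +
        (Real.pi * ((k μ : ℕ) : ℝ) / M + Real.pi / (2 * M))) ^ 2 := by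
  refine add_pos_of_nonneg_of_pos (sq_nonneg _) (lt_of_lt_of_le (sin_sq_pos (s 0).val (k 0).2) ?_)
  exact Finset.single_le_sum (f := fun μ => Real.sin (Real.pi * ((s μ).val : ℝ) +
    (Real.pi * ((k μ : ℕ) : ℝ) / M + Real.pi / (2 * M))) ^ 2) (fun μ _ => sq_nonneg _)
    (Finset.mem_univ 0)

/-! ### Real arithmetic -/

/-- The error coefficient of the block estimate is `≤ C₁ · √a · F'` when `a ≤ F'`
(`a` the maximal link deficit, `F'` the total link deficit). -/
theorem err_le {n CF Cop F a : ℝ} (hn : 0 ≤ n) (hCop : 0 ≤ Cop) (ha : 0 ≤ a) (haF : a ≤ F) :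
    8 * Real.sqrt (n * (CF * F)) * (Cop * a) + 2 * (CF * F) * Real.sqrt (Cop * a) +
        2 * n * (Cop * a) * Real.sqrt (Cop * a) ≤
      (8 * Real.sqrt (n * CF) * Cop + 2 * CF * Real.sqrt Cop + 2 * n * Cop * Real.sqrt Cop) *
        (Real.sqrt a * F) := by
  have hF : 0 ≤ F := ha.trans haF
  obtain ⟨s, hs, rfl⟩ : ∃ s, 0 ≤ s ∧ a = s ^ 2 :=
    ⟨Real.sqrt a, Real.sqrt_nonneg _, (Real.sq_sqrt ha).symm⟩
  obtain ⟨t, ht, rfl⟩ : ∃ t, 0 ≤ t ∧ F = t ^ 2 :=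
    ⟨Real.sqrt F, Real.sqrt_nonneg _, (Real.sq_sqrt hF).symm⟩
  have hst : s ≤ t := by nlinarith
  rw [Real.sqrt_sq hs, show n * (CF * t ^ 2) = (n * CF) * t ^ 2 by ring,
    Real.sqrt_mul' _ (sq_nonneg t), Real.sqrt_sq ht, Real.sqrt_mul' _ (sq_nonneg s), Real.sqrt_sq hs]
  have h1 : 0 ≤ 8 * Real.sqrt (n * CF) * Cop * s * t * (t - s) :=
    mul_nonneg (by positivity) (sub_nonneg.2 hst)
  have h2 : 0 ≤ 2 * n * Cop * Real.sqrt Cop * s * (t ^ 2 - s ^ 2) :=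
    mul_nonneg (by positivity) (sub_nonneg.2 (pow_le_pow_left₀ hs hst 2))
  nlinarith [h1, h2]

/-- Choice of the link threshold `η`: `0 < η ≤ η₀` with `A √η ≤ c_q / 2`. -/
theorem exists_eta {A cq η₀ : ℝ} (hA : 0 ≤ A) (hcq : 0 < cq) (hη₀ : 0 < η₀) :
    ∃ η : ℝ, 0 < η ∧ η ≤ η₀ ∧ A * Real.sqrt η ≤ cq / 2 := by
  refine ⟨min η₀ ((cq / (2 * A + 1)) ^ 2), lt_min hη₀ (by positivity), min_le_left _ _, ?_⟩
  have h1 : Real.sqrt (min η₀ ((cq / (2 * A + 1)) ^ 2)) ≤ cq / (2 * A + 1) :=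
    (Real.sqrt_le_sqrt (min_le_right _ _)).trans_eq (Real.sqrt_sq (by positivity))
  calc A * Real.sqrt (min η₀ ((cq / (2 * A + 1)) ^ 2)) ≤ A * (cq / (2 * A + 1)) := by gcongr
    _ ≤ cq / 2 := by
      rw [mul_div_assoc', div_le_div_iff₀ (by positivity) (by positivity)]
      nlinarith

/-- The final bookkeeping of the exponent. -/
theorem exponent_le {Q T E S F F' a η M4 Kq cq Cq C₁ CS CB : ℝ}
    (hQ : Q ≤ Kq - cq * M4 * S + Cq * Real.sqrt η * M4 * F) (hT : T ≤ CS * M4)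
    (hE : E ≤ C₁ * (Real.sqrt a * F')) (hE0 : 0 ≤ E) (haη : a ≤ η) (ha : 0 ≤ a) (haF : a ≤ F')
    (hF' : F' ≤ 2 * F) (hFS : F ≤ CB * S) (hS : 0 ≤ S) (hF : 0 ≤ F) (hM4 : 0 ≤ M4)
    (hC₁ : 0 ≤ C₁)
    (hkey : (max Cq 0 + 2 * C₁ * max CS 0) * max CB 0 * Real.sqrt η ≤ cq / 2) :
    Q + E * T ≤ Kq - cq / 2 * M4 * S := by
  have hη : Real.sqrt a ≤ Real.sqrt η := Real.sqrt_le_sqrt haη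
  have hF'0 : 0 ≤ F' := ha.trans haF
  have h1 : E * T ≤ 2 * C₁ * max CS 0 * Real.sqrt η * M4 * F :=
    calc E * T ≤ E * (max CS 0 * M4) :=
          mul_le_mul_of_nonneg_left (hT.trans (by gcongr; exact le_max_left _ _)) hE0
      _ ≤ C₁ * (Real.sqrt a * F') * (max CS 0 * M4) := by gcongr
      _ ≤ C₁ * (Real.sqrt η * (2 * F)) * (max CS 0 * M4) := by gcongr
      _ = 2 * C₁ * max CS 0 * Real.sqrt η * M4 * F := by ring
  have h2 : Cq * Real.sqrt η * M4 * F ≤ max Cq 0 * Real.sqrt η * M4 * F := by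
    gcongr; exact le_max_left _ _
  have h3 : F ≤ max CB 0 * S := hFS.trans (by gcongr; exact le_max_left _ _)
  have h4 : (max Cq 0 + 2 * C₁ * max CS 0) * Real.sqrt η * M4 * F ≤
      (max Cq 0 + 2 * C₁ * max CS 0) * Real.sqrt η * M4 * (max CB 0 * S) := by gcongr
  have h5 : (max Cq 0 + 2 * C₁ * max CS 0) * max CB 0 * Real.sqrt η * (M4 * S) ≤
      cq / 2 * (M4 * S) := mul_le_mul_of_nonneg_right hkey (by positivity)
  nlinarith [h1, h2, h4, h5]

/-- Product → sum: per-block bounds `‖b_k‖ ≤ ‖b⁰_k‖ e^{x_k}` multiply to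
`‖∏ b_k‖ ≤ e^{Σ x_k} ‖∏ b⁰_k‖`. -/
theorem norm_prod_le_exp {K : Type*} [Fintype K] {b b0 : K → ℂ} {x : K → ℝ}
    (h : ∀ k, ‖b k‖ ≤ ‖b0 k‖ * Real.exp (x k)) :
    ‖∏ k, b k‖ ≤ Real.exp (∑ k, x k) * ‖∏ k, b0 k‖ := by
  rw [norm_prod, norm_prod, Real.exp_sum, mul_comm, ← Finset.prod_mul_distrib]
  exact Finset.prod_le_prod (fun k _ => norm_nonneg _) fun k _ => h k

end CellGainCore

open CellGainCore

/-- **Stub 3z — the assembly.**  The one-loop margin `P6` implies the one-cell gain in tiling form for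
good-gauge cells on the even tori `(ℤ/2M)⁴`: Bloch factorisation into the blocks `B_k`, `B⁰_k`
(`stub_cellDetFactorisation`), coercivity of the free blocks (`stub_freeBlochBlocks`), smallness of
`Δ_k = B_k − B⁰_k` (`stub_deltaBounds`, `stub_tilingCellData`), the block estimate
(`stub_blockEstimate`), the lattice sum (`stub_blochLatticeSum`) and `P6`, combined by real arithmetic
with `c_g = c_q / 2`, `K_g = K_q`, `ε = min ε_q ε_Σ`, `η = min η₀ η₁`. -/
theorem stub_cellGainCore : (∃ cq Cq Kq ε η₀ : ℝ, 0 < cq ∧ 0 < ε ∧ 0 < η₀ ∧ ∃ M₀ : ℕ, ∀ (M : ℕ) [NeZero M], M₀ ≤ M → ∀ (m : ℝ), |m| ≤ ε → ∀ (V : GaugeConfig 4 (2 * M) (Matrix.unitaryGroup (Fin 3) ℂ)) (c : Site 4 (2 * M)) (ω : Matrix.unitaryGroup (Fin 3) ℂ) (ζ : (Fin 4 → Fin M) → Fin 4 → Matrix.unitaryGroup (Fin 3) ℂ), ((ω : Matrix.unitaryGroup (Fin 3) ℂ) : Matrix (Fin 3) (Fin 3) ℂ) = Complex.exp (↑(Real.pi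 / (2 * M : ℕ)) * Complex.I) • (1 : Matrix (Fin 3) (Fin 3) ℂ) → (∀ k μ, ((ζ k μ : Matrix.unitaryGroup (Fin 3) ℂ) : Matrix (Fin 3) (Fin 3) ℂ) = Complex.exp (Real.pi * Complex.I * ((k μ : ℕ) : ℂ) / (M : ℂ)) • (1 : Matrix (Fin 3) (Fin 3) ℂ)) → ∀ η : ℝ, η ≤ η₀ → (∀ e : Edge 4 (2 * M), ((∀ ν, (e.1 ν - c ν).val ≤ 1) ∧ (e.1 e.2 - c e.2).val = 0) → 3 - ((V e : Matrix.unitaryGroup (Fin 3) ℂ) : Matrix (Fin 3) (Fin 3) ℂ).trace.re ≤ η) → let tile : Site 4 (2 * M) → GaugeConfig 4 (2 * M) (Matrix.unitaryGroup (Fin 3) ℂ) → GaugeConfig 4 (2 * M) (Matrix.unitaryGroup (Fin 3) ℂ) := fun c V e => if (e.1 e.2 - c e.2).val % 2 = 0 then V (fun ν => c ν + (((e.1 ν - c ν).val % 2 : ℕ) : ZMod (2 * M)), e.2) else (V (fun ν => c ν + (((Site.shift e.1 e.2 ν - c ν).val % 2 : ℕ) : ZMod (2 * M)), e.2))⁻¹;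 let Wc : GaugeConfig 4 2 (Matrix.unitaryGroup (Fin 3) ℂ) := fun e => tile c V (fun ν => c ν + (((e.1 ν).val : ℕ) : ZMod (2 * M)), e.2); let R : (Fin 4 → Fin M) → Matrix (TorusSite 4 2 × Fin 3 × Fin 4) (TorusSite 4 2 × Fin 3 × Fin 4) ℂ := fun k => (wilsonDirac (unitaryFundamentalRep (Fin 3) ℂ) (fun e : Edge 4 2 => ζ k e.2 * ω) m 1)⁻¹ * (wilsonDirac (unitaryFundamentalRep (Fin 3) ℂ) (fun e : Edge 4 2 => ζ k e.2 * ω * Wc e) m 1 - wilsonDirac (unitaryFundamentalRep (Fin 3) ℂ) (fun e : Edge 4 2 => ζ k e.2 * ω) m 1); ∑ k : Fin 4 → Fin M, ((R k).trace.re - ((R k) * (R k)).trace.re / 2) ≤ Kq - cq * (M : ℝ) ^ 4 * ∑ p ∈ univ.filter (fun p : Plaquette 4 (2 * M) => p.1 p.2.1.1 = c p.2.1.1 ∧ p.1 p.2.1.2 = c p.2.1.2 ∧ ∀ ν, ν ≠ p.2.1.1 → ν ≠ p.2.1.2 → (p.1 ν = c ν ∨ p.1 ν = c ν + 1)), (3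 - (unitaryFundamentalRep (Fin 3) ℂ (plaquetteHolonomy V p.1 p.2.1.1 p.2.1.2)).trace.re) + Cq * Real.sqrt η * (M : ℝ) ^ 4 * ∑ e ∈ univ.filter (fun e : Edge 4 (2 * M) => (∀ ν, (e.1 ν - c ν).val ≤ 1) ∧ (e.1 e.2 - c e.2).val = 0), (3 - ((V e : Matrix.unitaryGroup (Fin 3) ℂ) : Matrix (Fin 3) (Fin 3) ℂ).trace.re)) → (∀ CB : ℝ, ∃ η cg Kg ε : ℝ, 0 < η ∧ 0 < cg ∧ 0 < ε ∧ ∃ M₀ : ℕ, ∀ (M : ℕ) [NeZero M], M₀ ≤ M → ∀ (m : ℝ), |m| ≤ ε → ∀ (V : GaugeConfig 4 (2 * M) (Matrix.unitaryGroup (Fin 3) ℂ)) (c : Site 4 (2 * M)), (∀ e : Edge 4 (2 * M), ((∀ ν, (e.1 ν - c ν).val ≤ 1) ∧ (e.1 e.2 - c e.2).val = 0) → 3 - (V e).1.trace.re ≤ η) → (∑ e ∈ univ.filter (fun e : Edge 4 (2 * M) => (∀ ν, (e.1 ν - c ν).val ≤ 1) ∧ (e.1 e.2 - c e.2).val = 0),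 (3 - (V e).1.trace.re)) ≤ CB * ∑ p ∈ univ.filter (fun p : Plaquette 4 (2 * M) => p.1 p.2.1.1 = c p.2.1.1 ∧ p.1 p.2.1.2 = c p.2.1.2 ∧ ∀ ν, ν ≠ p.2.1.1 → ν ≠ p.2.1.2 → (p.1 ν = c ν ∨ p.1 ν = c ν + 1)), (3 - (unitaryFundamentalRep (Fin 3) ℂ (plaquetteHolonomy V p.1 p.2.1.1 p.2.1.2)).trace.re) → let tile : Site 4 (2 * M) → GaugeConfig 4 (2 * M) (Matrix.unitaryGroup (Fin 3) ℂ) → GaugeConfig 4 (2 * M) (Matrix.unitaryGroup (Fin 3) ℂ) := fun c V e => if (e.1 e.2 - c e.2).val % 2 = 0 then V (fun ν => c ν + (((e.1 ν - c ν).val % 2 : ℕ) : ZMod (2 * M)), e.2) else (V (fun ν => c ν + (((Site.shift e.1 e.2 ν - c ν).val % 2 : ℕ) : ZMod (2 * M)), e.2))⁻¹; ‖(wilsonDirac (unitaryFundamentalRep (Fin 3) ℂ) (fun e => if (e.1 e.2).val + 1 = 2 * M then -(tile c V e) else tile c V e) m 1).det‖ ≤ Real.exp (Kg - cg * (M : ℝ)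 ^ 4 * ∑ p ∈ univ.filter (fun p : Plaquette 4 (2 * M) => p.1 p.2.1.1 = c p.2.1.1 ∧ p.1 p.2.1.2 = c p.2.1.2 ∧ ∀ ν, ν ≠ p.2.1.1 → ν ≠ p.2.1.2 → (p.1 ν = c ν ∨ p.1 ν = c ν + 1)), (3 - (unitaryFundamentalRep (Fin 3) ℂ (plaquetteHolonomy V p.1 p.2.1.1 p.2.1.2)).trace.re)) * ‖(wilsonDirac (unitaryFundamentalRep (Fin 3) ℂ) (fun e : Edge 4 (2 * M) => if (e.1 e.2).val + 1 = 2 * M then (-1 : Matrix.unitaryGroup (Fin 3) ℂ) else 1) m 1).det‖) := by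
  rintro ⟨cq, Cq, Kq, εq, η₀, hcq, hεq, hη₀, M₀q, hP⟩ CB
  obtain ⟨CF, Cop, hΔ⟩ := stub_deltaBounds
  obtain ⟨CS, εS, hεS, hLS⟩ := stub_blochLatticeSum
  -- constants
  set n : ℝ := (Fintype.card (TorusSite 4 2 × Fin 3 × Fin 4) : ℝ)
  have hn : 0 ≤ n := Nat.cast_nonneg _
  set CF' : ℝ := max CF 0
  set Cop' : ℝ := max Cop 0
  set C₁ : ℝ :=
    8 * Real.sqrt (n * CF') * Cop' + 2 * CF' * Real.sqrt Cop' + 2 * n * Cop' * Real.sqrt Cop'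
  have hC₁ : 0 ≤ C₁ := by positivity
  obtain ⟨η, hη, hηη₀, hkey⟩ :=
    exists_eta (A := (max Cq 0 + 2 * C₁ * max CS 0) * max CB 0) (by positivity) hcq hη₀
  refine ⟨η, cq / 2, Kq, min εq εS, hη, by positivity, lt_min hεq hεS, M₀q, ?_⟩
  intro M _ hM m hm V c hlinks hgauge tile
  have hmq : |m| ≤ εq := hm.trans (min_le_left _ _)
  have hmS : |m| ≤ εS := hm.trans (min_le_right _ _)
  -- the two cell sums
  set S : ℝ := ∑ p ∈ univ.filter (fun p : Plaquette 4 (2 * M) => p.1 p.2.1.1 = c p.2.1.1 ∧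
      p.1 p.2.1.2 = c p.2.1.2 ∧ ∀ ν, ν ≠ p.2.1.1 → ν ≠ p.2.1.2 → (p.1 ν = c ν ∨ p.1 ν = c ν + 1)),
    (3 - (unitaryFundamentalRep (Fin 3) ℂ (plaquetteHolonomy V p.1 p.2.1.1 p.2.1.2)).trace.re)
  set F : ℝ := ∑ e ∈ univ.filter (fun e : Edge 4 (2 * M) => (∀ ν, (e.1 ν - c ν).val ≤ 1) ∧
      (e.1 e.2 - c e.2).val = 0), (3 - (V e).1.trace.re)
  have hS0 : 0 ≤ S := Finset.sum_nonneg fun p _ => CellGainOfGauged.deficit_nonneg _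
  have hF0 : 0 ≤ F := Finset.sum_nonneg fun e _ => CellGainOfGauged.deficit_nonneg _
  -- the phases `ω`, `ζ_k`
  obtain ⟨ω, hω⟩ : ∃ ω : Matrix.unitaryGroup (Fin 3) ℂ, (ω : Matrix (Fin 3) (Fin 3) ℂ) =
      Complex.exp (↑(Real.pi / (2 * M : ℕ)) * Complex.I) • (1 : Matrix (Fin 3) (Fin 3) ℂ) :=
    ⟨⟨_, FreeDetFormula.phase_mem_unitaryGroup (2 * M)⟩, rfl⟩
  obtain ⟨ζ, hζ⟩ := exists_zeta M
  -- the cell field on the `2⁴`-torus and the blocks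
  set Wc : GaugeConfig 4 2 (Matrix.unitaryGroup (Fin 3) ℂ) := fun e =>
    tile c V (fun ν => c ν + (((e.1 ν).val : ℕ) : ZMod (2 * M)), e.2)
  set B0 : (Fin 4 → Fin M) →
      Matrix (TorusSite 4 2 × Fin 3 × Fin 4) (TorusSite 4 2 × Fin 3 × Fin 4) ℂ := fun k =>
    wilsonDirac (unitaryFundamentalRep (Fin 3) ℂ) (fun e : Edge 4 2 => ζ k e.2 * ω) m 1
  set B1 : (Fin 4 → Fin M) →
      Matrix (TorusSite 4 2 × Fin 3 × Fin 4) (TorusSite 4 2 × Fin 3 × Fin 4) ℂ := fun k =>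
    wilsonDirac (unitaryFundamentalRep (Fin 3) ℂ) (fun e : Edge 4 2 => ζ k e.2 * ω * Wc e) m 1
  -- the free symbol at the Bloch angles and its minimisers
  set hh : (Fin 4 → Fin M) → (Fin 4 → ZMod 2) → ℝ := fun k s =>
    (m + ∑ μ : Fin 4, (1 - Real.cos (Real.pi * ((s μ).val : ℝ) +
        (Real.pi * ((k μ : ℕ) : ℝ) / M + Real.pi / (2 * M))))) ^ 2 +
      ∑ μ : Fin 4, Real.sin (Real.pi * ((s μ).val : ℝ) +
        (Real.pi * ((k μ : ℕ) : ℝ) / M + Real.pi / (2 * M))) ^ 2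
  have hpos : ∀ k s, 0 < hh k s := fun k s => symbol_pos m k s
  have hmin : ∀ k, ∃ s₀, ∀ s, hh k s₀ ≤ hh k s := fun k => by
    obtain ⟨s₀, -, h⟩ := Finset.exists_min_image Finset.univ (hh k) Finset.univ_nonempty
    exact ⟨s₀, fun s => h s (Finset.mem_univ s)⟩
  choose s₀ hs₀ using hmin
  -- (3) the free blocks: coercivity
  have hfree : ∀ k, ‖(B0 k).det‖ ^ 2 = ∏ s, hh k s ^ 12 ∧ ∀ c₀ : ℝ, (∀ s, c₀ ≤ hh k s) →
      ∀ v : TorusSite 4 2 × Fin 3 × Fin 4 → ℂ,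
        c₀ * ∑ i, ‖v i‖ ^ 2 ≤ ∑ i, ‖((B0 k).mulVec v) i‖ ^ 2 := fun k =>
    stub_freeBlochBlocks (fun μ => Real.pi * ((k μ : ℕ) : ℝ) / M + Real.pi / (2 * M)) m
      (fun μ => ζ k μ * ω) (fun μ => coe_zeta_mul_omega hω (hζ k μ))
  -- (4) the tiling cell data and the maximal link deficit `a2`
  obtain ⟨hWlink, hWsum⟩ : (∀ e : Edge 4 2, ∃ e' : Edge 4 (2 * M),
      ((∀ ν, (e'.1 ν - c ν).val ≤ 1) ∧ (e'.1 e'.2 - c e'.2).val = 0) ∧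
        ((Wc e : Matrix.unitaryGroup (Fin 3) ℂ) : Matrix (Fin 3) (Fin 3) ℂ).trace.re =
          ((V e' : Matrix.unitaryGroup (Fin 3) ℂ) : Matrix (Fin 3) (Fin 3) ℂ).trace.re) ∧
      ∑ e : Edge 4 2, (3 - ((Wc e : Matrix.unitaryGroup (Fin 3) ℂ) :
        Matrix (Fin 3) (Fin 3) ℂ).trace.re) ≤ 2 * F :=
    stub_tilingCellData M V c
  obtain ⟨e₀, -, he₀⟩ := Finset.exists_max_image (univ : Finset (Edge 4 2)) (fun e =>
    3 - ((Wc e : Matrix.unitaryGroup (Fin 3) ℂ) : Matrix (Fin 3) (Fin 3) ℂ).trace.re) univ_nonempty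
  set a2 : ℝ := 3 - ((Wc e₀ : Matrix.unitaryGroup (Fin 3) ℂ) : Matrix (Fin 3) (Fin 3) ℂ).trace.re
    with ha2_def
  have hWa : ∀ e, 3 - ((Wc e : Matrix.unitaryGroup (Fin 3) ℂ) :
      Matrix (Fin 3) (Fin 3) ℂ).trace.re ≤ a2 := fun e => he₀ e (mem_univ e)
  have ha2 : 0 ≤ a2 := CellGainOfGauged.deficit_nonneg _
  have ha2η : a2 ≤ η := by
    obtain ⟨e', he', htr⟩ := hWlink e₀
    rw [ha2_def, htr]
    exact hlinks e' he'
  set F' : ℝ := ∑ e : Edge 4 2,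
    (3 - ((Wc e : Matrix.unitaryGroup (Fin 3) ℂ) : Matrix (Fin 3) (Fin 3) ℂ).trace.re)
  have ha2F' : a2 ≤ F' :=
    Finset.single_le_sum (f := fun e => 3 - ((Wc e : Matrix.unitaryGroup (Fin 3) ℂ) :
      Matrix (Fin 3) (Fin 3) ℂ).trace.re) (fun e _ => CellGainOfGauged.deficit_nonneg _) (mem_univ e₀)
  have hF'0 : 0 ≤ F' := ha2.trans ha2F'
  have hΔk : ∀ k, (∑ i, ∑ j, ‖(B1 k - B0 k) i j‖ ^ 2 ≤ CF * F') ∧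
      ∀ v : TorusSite 4 2 × Fin 3 × Fin 4 → ℂ,
        ∑ i, ‖((B1 k - B0 k).mulVec v) i‖ ^ 2 ≤ Cop * a2 * ∑ i, ‖v i‖ ^ 2 := fun k =>
    hΔ m (fun μ => ζ k μ * ω) Wc a2 hWa
  -- (5) the block estimate, block by block
  set q : (Fin 4 → Fin M) → ℝ := fun k => ((B0 k)⁻¹ * (B1 k - B0 k)).trace.re -
    (((B0 k)⁻¹ * (B1 k - B0 k)) * ((B0 k)⁻¹ * (B1 k - B0 k))).trace.re / 2
  set t : (Fin 4 → Fin M) → ℝ := fun k => Real.sqrt (hh k (s₀ k)) / hh k (s₀ k) ^ 2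
  set E : ℝ := 8 * Real.sqrt (n * (CF' * F')) * (Cop' * a2) +
    2 * (CF' * F') * Real.sqrt (Cop' * a2) + 2 * n * (Cop' * a2) * Real.sqrt (Cop' * a2)
  have hΦ : 0 ≤ CF' * F' := mul_nonneg (le_max_right _ _) hF'0
  have hα : 0 ≤ Cop' * a2 := mul_nonneg (le_max_right _ _) ha2
  have hE0 : 0 ≤ E :=
    add_nonneg (add_nonneg (mul_nonneg (mul_nonneg (by norm_num) (Real.sqrt_nonneg _)) hα)
      (mul_nonneg (mul_nonneg two_pos.le hΦ) (Real.sqrt_nonneg _)))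
      (mul_nonneg (mul_nonneg (mul_nonneg two_pos.le hn) hα) (Real.sqrt_nonneg _))
  have hblock : ∀ k, ‖(B1 k).det‖ ≤ ‖(B0 k).det‖ * Real.exp (q k + E * t k) := by
    intro k
    have hFr : ∑ i, ∑ j, ‖(B1 k - B0 k) i j‖ ^ 2 ≤ CF' * F' :=
      (hΔk k).1.trans (mul_le_mul_of_nonneg_right (le_max_left _ _) hF'0)
    have hop : ∀ v : TorusSite 4 2 × Fin 3 × Fin 4 → ℂ,
        ∑ i, ‖((B1 k - B0 k).mulVec v) i‖ ^ 2 ≤ Cop' * a2 * ∑ i, ‖v i‖ ^ 2 := fun v =>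
      ((hΔk k).2 v).trans (mul_le_mul_of_nonneg_right (mul_le_mul_of_nonneg_right
        (le_max_left _ _) ha2) (Finset.sum_nonneg fun i _ => by positivity))
    have hk := stub_blockEstimate (B0 k) (B1 k - B0 k) (hh k (s₀ k)) (CF' * F') (Cop' * a2)
      (hpos k _) hΦ hα ((hfree k).2 _ (hs₀ k)) hFr hop
    rw [add_sub_cancel] at hk
    exact hk
  -- (7) the lattice sum
  have ht : ∑ k, t k ≤ CS * (M : ℝ) ^ 4 :=
    calc ∑ k, t k ≤ ∑ k : Fin 4 → Fin M, ∑ s : Fin 4 → ZMod 2, Real.sqrt (hh k s) / hh k s ^ 2 :=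
          Finset.sum_le_sum fun k _ => Finset.single_le_sum
            (f := fun s => Real.sqrt (hh k s) / hh k s ^ 2)
            (fun s _ => div_nonneg (Real.sqrt_nonneg _) (sq_nonneg _)) (mem_univ (s₀ k))
      _ ≤ CS * (M : ℝ) ^ 4 := hLS M m hmS
  -- (8) the error algebra
  have hE : E ≤ C₁ * (Real.sqrt a2 * F') := err_le hn (le_max_right _ _) ha2 ha2F'
  -- (9) the one-loop margin
  have hq : ∑ k, q k ≤ Kq - cq * (M : ℝ) ^ 4 * S + Cq * Real.sqrt η * (M : ℝ) ^ 4 * F :=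
    hP M hM m hmq V c ω ζ hω hζ η hηη₀ hlinks
  -- (10) combine
  have hexp : ∑ k, (q k + E * t k) ≤ Kq - cq / 2 * (M : ℝ) ^ 4 * S := by
    rw [Finset.sum_add_distrib, ← Finset.mul_sum]
    exact exponent_le hq ht hE hE0 ha2η ha2 ha2F' hWsum hgauge hS0 hF0 (by positivity) hC₁ hkey
  -- (2) + (6) factorisation and product → sum
  obtain ⟨hT, hT₀⟩ : (wilsonDirac (unitaryFundamentalRep (Fin 3) ℂ)
      (fun e => if (e.1 e.2).val + 1 = 2 * M then -(tile c V e) else tile c V e) m 1).det =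
        ∏ k : Fin 4 → Fin M, (B1 k).det ∧
      (wilsonDirac (unitaryFundamentalRep (Fin 3) ℂ) (fun e : Edge 4 (2 * M) =>
        if (e.1 e.2).val + 1 = 2 * M then (-1 : Matrix.unitaryGroup (Fin 3) ℂ) else 1) m 1).det =
        ∏ k : Fin 4 → Fin M, (B0 k).det :=
    stub_cellDetFactorisation M m V c ω ζ hω hζ
  have key : ‖∏ k : Fin 4 → Fin M, (B1 k).det‖ ≤
      Real.exp (Kq - cq / 2 * (M : ℝ) ^ 4 * S) * ‖∏ k : Fin 4 → Fin M, (B0 k).det‖ :=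
    (norm_prod_le_exp hblock).trans
      (mul_le_mul_of_nonneg_right (Real.exp_le_exp.2 hexp) (norm_nonneg _))
  rw [← hT, ← hT₀] at key
  exact key

end Summit.QuantumFields.QCD.Cruxes.CriticalLineDiamagnetism.ChessboardCellGain

end
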